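import Mathlib
import Literature.AlgebraicGeometry.Resolution.BlowupTowerPotential
import Literature.AlgebraicGeometry.Resolution.LocalBlowupChainBound
import Literature.AlgebraicGeometry.Resolution.AnalyticallyUnramifiedQuotient
import HarnessLib

/-!
# Krull's blow-up tower: the branches of one local quadratic transform (Kollár Thm. 1.101, step)

Topic: `Literature/AlgebraicGeometry/Resolution`. First half of the DISCHARGE of the named fact
`Kollar2007_thm_1_101_localChain` (`OneDimensionalBlowupTower.lean`; Kollár 2007, Thm. 1.101 with
Alg. 1.100; Krull 1930): for `R` in the class «reduced Noetherian local, every minimal prime `q`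
with `dim R/q = 1` and `R/q` of finite normalization» and a local quadratic transform
`S = (B_i)_𝔴` (`𝔴` over `𝔪_R` in a chart of `Bl_𝔪 Spec R`), the branch of `S` at a passing minimal
prime `q` (`𝔔 = ker ψ_q`, `ReducedQuadraticTransformBranches.lean`) is a quadratic transform of
`θ_q(R) ≅ R/q` (`QuadraticTransformDelta.lean`): `branch_step` — `S/𝔔` is one-dimensional with
finite normalization, `δ(S/𝔔) ≤ δ(R/q)` with equality only if `R/q` is regular, and for a second
passing `q' ≠ q` the contact order of `q'` along `q` drops (`BranchContactOrder.lean`). Also: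
`one_le_branchContact`, `towerPotential_ne_top` (finiteness of the potential on the class).
Sequel: `OneDimensionalBlowupTowerProof.lean` (the one-step drop of the potential and the named
fact). All PROVED.

## Sources

* J. Kollár, *Lectures on Resolution of Singularities*, Ann. of Math. Stud. 166 (2007), §1.4,
  Def. 1.97, Lemma 1.99, Alg. 1.100, Thm. 1.101 (pp. 57–59). [Kollar2007]
-/

noncomputable section

open IsLocalRing

namespace Literature.AlgebraicGeometry.Resolution

universe u

/-! ## The branch data of a local quadratic transform -/

section Step

variable {R : Type u} [CommRing R] [IsLocalRing R] [IsNoetherianRing R] [IsReduced R]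
  (hdim : ∀ q ∈ minimalPrimes R, ringKrullDim (R ⧸ q) = 1)
  (hfin : ∀ (q : Ideal R) [q.IsPrime], q ∈ minimalPrimes R →
    Module.Finite (R ⧸ q) (integralClosure (R ⧸ q) (FractionRing (R ⧸ q))))
  {k : ℕ} (c : Fin k → R) (hc : Ideal.span (Set.range c) = maximalIdeal R) (i : Fin k)
  (𝔴 : Ideal (chartRing c i)) [𝔴.IsPrime] (h𝔴 : 𝔴.comap (chartBase c i) = maximalIdeal R)
  (S : Type u) [CommRing S] [IsLocalRing S] [Algebra (chartRing c i) S] [IsLocalization.AtPrime S 𝔴]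

omit [IsReduced R] in
include hdim hfin in
/-- The branch ring `θ_q(R)` of a minimal prime: Noetherian, of dimension one, not a field, a local
ring of `Frac(R/q)`, with finite (Dedekind) normalization. [cite: Kollar2007, §1.4] -/
private theorem branchRing_facts (q : Ideal R) [q.IsPrime] (hqm : q ∈ minimalPrimes R) :
    haveI := isLocalRing_range_branchPoint q (R := R)
    IsNoetherianRing (branchPoint q).range ∧ ringKrullDim (branchPoint q).range = 1 ∧
      ¬ IsField (branchPoint q).range ∧ IsLocalRingOf (branchPoint q).range ∧
      IsFractionRing (branchPoint q).range (FractionRing (R ⧸ q)) ∧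
      Module.Finite (branchPoint q).range
        (integralClosure (branchPoint q).range (FractionRing (R ⧸ q))) := by
  haveI := isLocalRing_range_branchPoint q (R := R)
  have e := quotientEquivRangeBranchPoint q (R := R)
  have hN : IsNoetherianRing (branchPoint q).range := isNoetherianRing_of_ringEquiv _ e
  have hd : ringKrullDim (branchPoint q).range = 1 := by
    rw [← ringKrullDim_eq_of_ringEquiv e]; exact hdim q hqm
  have hof := isLocalRingOf_range_branchPoint q (R := R)
  haveI hfr : IsFractionRing (branchPoint q).range (FractionRing (R ⧸ q)) :=
    isFractionRing_of_isLocalRingOf_le hof.2 le_rfl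
  haveI := hfin q hqm
  have hF : Module.Finite (branchPoint q).range
      (integralClosure (branchPoint q).range (FractionRing (R ⧸ q))) :=
    module_finite_integralClosure_of_ringEquiv e (FractionRing (R ⧸ q)) (FractionRing (R ⧸ q))
  exact ⟨hN, hd, (ringKrullDim_eq_one_iff_of_isLocalRing_isDomain.mp hd).1, hof, hfr, hF⟩


omit [IsLocalRing R] [IsNoetherianRing R] [IsReduced R] [IsLocalRing S] in
/-- The kernel `ker ψ_q` depends only on the ideal `q`. [cite: Kollar2007, §1.4] -/
theorem ker_branchMap_congr {q₁ q₂ : Ideal R} [q₁.IsPrime] [q₂.IsPrime] (h : q₁ = q₂)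
    (hq₁ : c i ∉ q₁) (hq₂ : c i ∉ q₂)
    (hpass₁ : RingHom.ker (chartBranchMap c i q₁ hq₁) ≤ 𝔴)
    (hpass₂ : RingHom.ker (chartBranchMap c i q₂ hq₂) ≤ 𝔴) :
    RingHom.ker (branchMap c i q₁ hq₁ 𝔴 S hpass₁) = RingHom.ker (branchMap c i q₂ hq₂ 𝔴 S hpass₂) := by
  subst h
  rfl

omit [IsReduced R] [IsLocalRing S] in
include hdim hfin hc h𝔴 in
/-- **The branch of `S` on a passing minimal prime `q`**: with `𝔔 = ker ψ_q`, `S/𝔔 ≅ ψ_q(S)` is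
a quadratic transform of `θ_q(R) ≅ R/q`, hence one-dimensional with finite normalization;
`δ(S/𝔔) ≤ δ(R/q)` with equality only if `R/q` is regular; and for a second passing minimal prime
`q' ≠ q` the contact order of the branch `q'` along `q` drops by at least one.
[cite: Kollar2007, §1.4, Alg. 1.100, Thm. 1.101] -/
theorem branch_step (q : Ideal R) [q.IsPrime] (hqm : q ∈ minimalPrimes R) (hq : c i ∉ q)
    (hpass : RingHom.ker (chartBranchMap c i q hq) ≤ 𝔴) :
    ringKrullDim (S ⧸ RingHom.ker (branchMap c i q hq 𝔴 S hpass)) = 1 ∧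
    (haveI : (RingHom.ker (branchMap c i q hq 𝔴 S hpass)).IsPrime := RingHom.ker_isPrime _
     Module.Finite (S ⧸ RingHom.ker (branchMap c i q hq 𝔴 S hpass))
      (integralClosure (S ⧸ RingHom.ker (branchMap c i q hq 𝔴 S hpass))
        (FractionRing (S ⧸ RingHom.ker (branchMap c i q hq 𝔴 S hpass))))) ∧
    branchDelta S (RingHom.ker (branchMap c i q hq 𝔴 S hpass)) ≤ branchDelta R q ∧
    (branchDelta S (RingHom.ker (branchMap c i q hq 𝔴 S hpass)) = branchDelta R q →
      IsRegularLocalRing (R ⧸ q)) ∧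
    (∀ (q' : Ideal R) [q'.IsPrime] (hq' : c i ∉ q')
      (hpass' : RingHom.ker (chartBranchMap c i q' hq') ≤ 𝔴), q' ∈ minimalPrimes R → q' ≠ q →
      branchContact S (RingHom.ker (branchMap c i q hq 𝔴 S hpass))
          (RingHom.ker (branchMap c i q' hq' 𝔴 S hpass')) + 1 ≤ branchContact R q q') := by
  -- the branch ring `A = θ_q(R)` and its data
  haveI := isLocalRing_range_branchPoint q (R := R)
  obtain ⟨hN, hdA, hDA, hof, hfr, hF⟩ := branchRing_facts hdim hfin q hqm
  haveI := hN; haveI := hfr; haveI := hF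
  haveI : IsDedekindDomain (integralClosure (branchPoint q).range (FractionRing (R ⧸ q))) :=
    isDedekindDomain_integralClosure_of_module_finite _ _ hdA.le
  haveI : IsFractionRing (integralClosure (branchPoint q).range (FractionRing (R ⧸ q)))
      (FractionRing (R ⧸ q)) := isFractionRing_integralClosure _ _
  -- the quadratic transform `D₁ = ψ_q(S)` and `S/𝔔 ≅ D₁`
  set ψ := branchMap c i q hq 𝔴 S hpass with hψ
  have hQT : IsQuadraticTransform (branchPoint q).range ψ.range :=
    isQuadraticTransform_range_branchMap c i hc q hq 𝔴 h𝔴 S hpass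
  haveI : IsLocalRing ψ.range := hQT.isLocalRing
  haveI hfr₁ : IsFractionRing ψ.range (FractionRing (R ⧸ q)) :=
    isFractionRing_of_isLocalRingOf_le hof.2 hQT.le'
  haveI : (RingHom.ker ψ).IsPrime := RingHom.ker_isPrime _
  -- an explicit model of `S/𝔔 ≅ ψ(S)` computing on representatives
  let f₀ : S ⧸ RingHom.ker ψ →+* ψ.range :=
    Ideal.Quotient.lift (RingHom.ker ψ) ψ.rangeRestrict fun a ha =>
      Subtype.ext (by rw [RingHom.coe_rangeRestrict, (RingHom.mem_ker).mp ha]; rfl)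
  have hf₀mk : ∀ s : S, f₀ (Ideal.Quotient.mk _ s) = ψ.rangeRestrict s := fun s => rfl
  have hf₀ : Function.Bijective f₀ := by
    refine ⟨(injective_iff_map_eq_zero f₀).mpr fun x hx => ?_, fun y => ?_⟩
    · obtain ⟨s, rfl⟩ := Ideal.Quotient.mk_surjective x
      rw [hf₀mk] at hx
      exact Ideal.Quotient.eq_zero_iff_mem.mpr ((RingHom.mem_ker).mpr (congrArg Subtype.val hx))
    · obtain ⟨s, hs⟩ := ψ.rangeRestrict_surjective y
      exact ⟨Ideal.Quotient.mk _ s, by rw [hf₀mk, hs]⟩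
  let e₁ : S ⧸ RingHom.ker ψ ≃+* ψ.range := RingEquiv.ofBijective f₀ hf₀
  have he₁ : ∀ s : S, ((e₁ (Ideal.Quotient.mk _ s) : ψ.range) : FractionRing (R ⧸ q)) = ψ s :=
    fun s => by rw [RingEquiv.ofBijective_apply, hf₀mk]; rfl
  refine ⟨?_, ?_, ?_, ?_, ?_⟩
  · rw [ringKrullDim_eq_of_ringEquiv e₁]; exact hQT.ringKrullDim_eq_one hof hDA hdA
  · haveI := hQT.module_finite_integralClosure hof
    exact module_finite_integralClosure_of_ringEquiv e₁.symm (FractionRing (R ⧸ q)) _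
  · -- `δ(S/𝔔) = δ(D₁) ≤ δ(A) = δ(R/q)`
    rw [branchDelta_eq, branchDelta_eq, curveDelta_eq_of_ringEquiv e₁ _ (FractionRing (R ⧸ q)),
      curveDelta_eq_of_ringEquiv (quotientEquivRangeBranchPoint q (R := R)) _ (FractionRing (R ⧸ q))]
    by_cases hDVR : IsDiscreteValuationRing (branchPoint q).range
    · have heq : ψ.range = (branchPoint q).range := hQT.eq_self_of_isDiscreteValuationRing
      exact (curveDelta_eq_of_ringEquiv (RingEquiv.subringCongr heq) (FractionRing (R ⧸ q))
        (FractionRing (R ⧸ q))).le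
    · exact (hQT.curveDelta_lt hof hDA hdA hDVR).le
  · -- equality forces `A` to be a discrete valuation ring
    intro heq
    rw [branchDelta_eq, branchDelta_eq, curveDelta_eq_of_ringEquiv e₁ _ (FractionRing (R ⧸ q)),
      curveDelta_eq_of_ringEquiv (quotientEquivRangeBranchPoint q (R := R)) _ (FractionRing (R ⧸ q))]
      at heq
    by_cases hDVR : IsDiscreteValuationRing (branchPoint q).range
    · exact IsRegularLocalRing.of_ringEquiv (quotientEquivRangeBranchPoint q (R := R)).symm
    · exact absurd heq (hQT.curveDelta_lt hof hDA hdA hDVR).ne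
  · -- contact orders drop
    intro q' _ hq' hpass' hqm' hne
    set ψ' := branchMap c i q' hq' 𝔴 S hpass' with hψ'
    haveI : (RingHom.ker ψ').IsPrime := RingHom.ker_isPrime _
    -- `branchContact S 𝔔 𝔔'` computed in `Frac(R/q)` through `E : Frac(S/𝔔) ≅ Frac(R/q)`
    let E : FractionRing (S ⧸ RingHom.ker ψ) ≃+* FractionRing (R ⧸ q) :=
      IsFractionRing.ringEquivOfRingEquiv e₁
    have hE : ∀ s : S, E (branchPoint (RingHom.ker ψ) s) = ψ s := by
      intro s
      have h1 : branchPoint (RingHom.ker ψ) s =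
          algebraMap _ (FractionRing (S ⧸ RingHom.ker ψ)) (Ideal.Quotient.mk (RingHom.ker ψ) s) := rfl
      rw [h1, IsFractionRing.ringEquivOfRingEquiv_algebraMap, ← he₁ s]
      rfl
    have h1 : ((branchPoint (RingHom.ker ψ)).range).map (E : _ →+* _) = ψ.range := by
      ext x
      constructor
      · rintro ⟨_, ⟨s, rfl⟩, rfl⟩; exact ⟨s, (hE s).symm⟩
      · rintro ⟨s, rfl⟩; exact ⟨_, ⟨s, rfl⟩, hE s⟩
    have h2 : E '' (branchPoint (RingHom.ker ψ) '' (RingHom.ker ψ' : Set S)) =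
        ψ '' (RingHom.ker ψ' : Set S) := by
      ext x
      constructor
      · rintro ⟨_, ⟨s, hs, rfl⟩, rfl⟩; exact ⟨s, hs, (hE s).symm⟩
      · rintro ⟨s, hs, rfl⟩; exact ⟨_, ⟨s, hs, rfl⟩, hE s⟩
    rw [branchContact_eq, branchContact_eq, ← contactOrder_map_ringEquiv E, h1, h2]
    -- the element `x = θ_q(c_i)` and the hypotheses of `contactOrder_add_one_le`
    have hci : c i ∈ maximalIdeal R := hc ▸ Ideal.subset_span ⟨i, rfl⟩
    let t : (branchPoint q).range := ⟨branchPoint q (c i), ⟨c i, rfl⟩⟩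
    have ht : t ∈ maximalIdeal (branchPoint q).range :=
      (mem_maximalIdeal _).mpr (not_isUnit_rangeRestrict_branchPoint q hci)
    refine contactOrder_add_one_le (t := t) hDA hQT.le' ht ?_ ?_ ?_
    · rintro _ ⟨a, ha, rfl⟩
      have ha𝔪 : a ∈ maximalIdeal R := IsLocalRing.le_maximalIdeal Ideal.IsPrime.ne_top' ha
      exact ⟨⟨branchPoint q a, ⟨a, rfl⟩⟩,
        (mem_maximalIdeal _).mpr (not_isUnit_rangeRestrict_branchPoint q ha𝔪), rfl⟩
    · rintro _ ⟨a, ha, rfl⟩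
      obtain ⟨y, hy, hay⟩ := exists_mem_ker_branchMap_mul c i 𝔴 S hc q q' hq hq' hpass hpass' ha
      exact ⟨ψ y, ⟨y, rfl⟩, ⟨y, hy, rfl⟩, hay⟩
    · -- `𝔔' ⊄ 𝔔`: some `y ∈ 𝔔'` has `ψ y ≠ 0`
      have hnle := ker_branchMap_not_le c i 𝔴 S hqm hq hq' hpass hpass' (Ne.symm hne)
      obtain ⟨y, hy', hy⟩ := SetLike.not_le_iff_exists.mp hnle
      exact ⟨ψ y, ⟨y, hy', rfl⟩, ⟨y, rfl⟩, fun h0 => hy ((RingHom.mem_ker).mpr h0)⟩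

omit [IsReduced R] in
include hdim hfin in
/-- `contactOrder(θ_q(R), θ_q(q')) ≥ 1` for a minimal prime `q` and any prime `q'`.
[cite: Kollar2007, §1.4] -/
theorem one_le_branchContact (q q' : Ideal R) [q.IsPrime] [q'.IsPrime] (hqm : q ∈ minimalPrimes R) :
    1 ≤ branchContact R q q' := by
  haveI := isLocalRing_range_branchPoint q (R := R)
  obtain ⟨hN, hdA, hDA, hof, hfr, hF⟩ := branchRing_facts hdim hfin q hqm
  haveI := hN; haveI := hfr; haveI := hF
  haveI : IsDedekindDomain (integralClosure (branchPoint q).range (FractionRing (R ⧸ q))) :=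
    isDedekindDomain_integralClosure_of_module_finite _ _ hdA.le
  haveI : IsFractionRing (integralClosure (branchPoint q).range (FractionRing (R ⧸ q)))
      (FractionRing (R ⧸ q)) := isFractionRing_integralClosure _ _
  rw [branchContact_eq]
  refine one_le_contactOrder hDA ?_
  rintro _ ⟨a, ha, rfl⟩
  have ha𝔪 : a ∈ maximalIdeal R := IsLocalRing.le_maximalIdeal Ideal.IsPrime.ne_top' ha
  exact ⟨⟨branchPoint q a, ⟨a, rfl⟩⟩,
    (mem_maximalIdeal _).mpr (not_isUnit_rangeRestrict_branchPoint q ha𝔪), rfl⟩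

omit [IsReduced R] in
include hdim hfin in
/-- **The tower potential of a ring in the class is finite.** [cite: Kollar2007, §1.4] -/
theorem towerPotential_ne_top : towerPotential R ≠ ⊤ := by
  classical
  have hR : (minimalPrimes R).Finite := minimalPrimes.finite_of_isNoetherianRing R
  have hF : ∀ q, q ∈ hR.toFinset ↔ q ∈ minimalPrimes R := fun q => Set.Finite.mem_toFinset _
  rw [towerPotential_eq hR]
  refine ENat.sum_ne_top.mpr fun q hq => ?_
  have hqm := (hF q).mp hq
  haveI : q.IsPrime := hqm.1.1
  refine WithTop.add_ne_top.mpr ⟨?_, ENat.sum_ne_top.mpr fun q' hq' => ?_⟩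
  · rw [branchDelta_eq]
    haveI : IsLocalRing (R ⧸ q) :=
      IsLocalRing.of_surjective' (Ideal.Quotient.mk q) Ideal.Quotient.mk_surjective
    haveI := hfin q hqm
    exact curveDelta_ne_top (R := R ⧸ q) (K := FractionRing (R ⧸ q)) (hdim q hqm)
  · have hqm' := (hF q').mp (Finset.mem_of_mem_erase hq')
    haveI : q'.IsPrime := hqm'.1.1
    haveI := isLocalRing_range_branchPoint q (R := R)
    obtain ⟨hN, hdA, hDA, hof, hfr, hFin⟩ := branchRing_facts hdim hfin q hqm
    haveI := hN; haveI := hfr; haveI := hFin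
    haveI : IsDedekindDomain (integralClosure (branchPoint q).range (FractionRing (R ⧸ q))) :=
      isDedekindDomain_integralClosure_of_module_finite _ _ hdA.le
    haveI : IsFractionRing (integralClosure (branchPoint q).range (FractionRing (R ⧸ q)))
        (FractionRing (R ⧸ q)) := isFractionRing_integralClosure _ _
    rw [branchContact_eq]
    -- an element of `q' ∖ q` has nonzero image in the branch `q`
    have hnle : ¬ q' ≤ q := fun hle =>
      Finset.ne_of_mem_erase hq' (le_antisymm hle (hqm.2 ⟨hqm'.1.1, bot_le⟩ hle))
    obtain ⟨a, ha', ha⟩ := SetLike.not_le_iff_exists.mp hnle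
    exact contactOrder_ne_top ⟨branchPoint q a, ⟨a, ha', rfl⟩, ⟨a, rfl⟩,
      (branchPoint_ne_zero_iff q a).mpr ha⟩

end Step

end Literature.AlgebraicGeometry.Resolution
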